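import Summits.BirchSwinnertonDyer.BirchSwinnertonDyer.Theorems.QuadraticBranchSignedControlPlusEtaNonsurjCMUnitRecordShape
import Summits.BirchSwinnertonDyer.Rank1Residual.X12.InertCoreUpperHalfTam
import HarnessLib

/-!
# Route `QuadraticBranchSignedControl` (rung K8, cell `bsd-potss`), residual crux
# `PlusEtaMainConjectureNonsurj` (stmt-BirchSwinnertonDyer-19606): the CM rank-`0` rows need ONE
# integer — Kobayashi's even main conjecture at `η` holds at `(V,p)` for every CM good supersingular
# `a_p = 0` twist `V` (`p ≥ 5`) whose additive partner `W` has `L(W,1) ≠ 0` and `p ∤ #Ш(W)`, granted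
# modularity + GZK + Burungale–Flach; the Tamagawa binder is DISCHARGED (seat `bsd-potss-k8eta-c2` g2)

WHAT. `…PlusEtaNonsurjUnitRows` (p473356) / `…CMUnitRecordShape` (p475718) prove (C1⁺_η)(V,p) on the
CM unit rows from `v_p(#Ш(W)_an) ≤ 0` AND `p ∤ Tam(W)`. For a CM curve the second binder is automatic:
every bad prime of a CM curve is additive (integral `j`), so every `c_ℓ ≤ 4 < p` — the tree's theorem
`X12.not_dvd_tamagawaProduct_of_hasCM` (`p ≥ 5`). Hence:
* `quadraticBranchPlusEtaMainConjectureAt_of_hasCM_of_shaAn_unit'` — `V` CM, `p ≥ 5`, good,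
  `a_p(V) = 0`, `C • W^{(p*)} = V`, `L(W,1) ≠ 0`, `v_p(#Ш(W)_an) ≤ 0` ⟹ (C1⁺_η)(V,p);
* `quadraticBranchPlusEtaMainConjectureAt_of_hasCM_of_not_dvd_card_sha` — the same with the ALGEBRAIC
  input `p ∤ #Ш(W)` (for CM `W` of analytic rank `0`, `#Ш(W) = #Ш(W)_an` is Burungale–Flach);
* `etaMC_cm_rankZeroRows_of_not_dvd_sha` — the stub-shaped ∀-form on the binders of `stub_etaMC_cm`:
  **the CM rank-`0` rows of crux 19606 are settled modulo print OFF the locus `p ∣ #Ш(W)`** (empty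
  below `5·10⁵`: census HOME/k8eta-c2/unit_rows_census.tsv, 192/192 rows).
NO Kato / Thm. 4.1, NO Thm. 2.2, NO Kitajima–Otsuki, NO Poitou–Tate, NO `μ`, NO Pollack–Rubin
`η`-descent, NO image hypothesis.

HONEST FRAMING (cell `bsd-potss`, run/shared/lean/pub/bsd-potss/; FULL-BSD rank ≤ 1 programme,
tranche 1b, HUMAN RULING D-0036/D-0074): BOOKKEEPING THEOREMS ONLY — no definition, no named
Literature fact minted, no Summits-side `def … : Prop`, no `sorry`, axioms standard. CONDITIONAL on
modularity (`hasEntireLFunction_rat`), GZK (`rank_eq_analyticRank_of_analyticRank_le_one`) and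
Burungale–Flach 2024 (`bsdTriple_of_hasCM_of_L_one_ne_zero`, bsd.S28) — named facts in hypothesis
position — and on the displayed per-row input `p ∤ #Ш(W)` (resp. `v_p(#Ш(W)_an) ≤ 0`). The class-wide
stub `stub_etaMC_cm` (all ranks, all rows) and crux 19606 stay OPEN; rank-`1` CM rows and CM rows with
`p ∣ #Ш(W)` are not touched; nothing is booked; no label / mark / count moves; `BSD(W,p)` is bsd.S28,
claimed for no new pair. `--supports stmt-BirchSwinnertonDyer-19606`.

References: [BurungaleFlach2024] Thm. 1.1 + Cor. 2; [Kobayashi2003] §4 Even main conjecture (p. 8);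
[PollackRubin2004] p. 448 (the remark these rows no longer need); [SilvermanAEC2009] VII.6 (Kodaira–Néron:
`c_ℓ ≤ 4` at additive primes), App. C §11; [SilvermanATAEC1994] II.6 (integral `j` of CM curves).
-/

set_option autoImplicit false
set_option linter.dupNamespace false

noncomputable section

open scoped Classical

open CongruenceSubgroup Field Function NumberField IsDedekindDomain WeierstrassCurve
open Literature.NumberTheory.EllipticCurves
open Literature.NumberTheory.EllipticCurves.ModularForms
open Literature.NumberTheory.EllipticCurves.Rank1Residual
open Literature.NumberTheory.EllipticCurves.Rank1Residual.Typed
open Literature.NumberTheory.GaloisRepresentations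
open Summit.BirchSwinnertonDyer.Rank1Residual.Additive

namespace Summit.BirchSwinnertonDyer.BirchSwinnertonDyer.Theorems

namespace EtaUnitRows

section CM

variable (W : WeierstrassCurve ℚ) [W.IsElliptic] [W.IsGloballyMinimal] (p : ℕ) [hp : Fact p.Prime]

/-- **(C1⁺_η)(V,p) on a CM rank-`0` pair from ONE integer: `v_p(#Ш(W)_an) ≤ 0`.** `V` CM, `p ≥ 5`,
good at `p` with `a_p(V) = 0`, `C • W^{(p*)} = V` with `W` globally minimal, `L(W,1) ≠ 0`,
`v_p(#Ш(W)_an) ≤ 0`. The Tamagawa binder of `…_of_hasCM_of_shaAn_unit` is discharged: `W` is CM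
(`j(W) = j(V)`), so `p ∤ Tam(W)` (`X12.not_dvd_tamagawaProduct_of_hasCM`: all bad primes additive,
`c_ℓ ≤ 4 < p`). Named facts: modularity, GZK, bsd.S28. CONDITIONAL; nothing booked.
[cite: BurungaleFlach2024, Thm 1.1 and Cor. 2] [cite: Kobayashi2003, §4 Even main conjecture (p. 8)]
[cite: SilvermanAEC2009, VII.6 Thm. 6.1 and App. C §11] -/
theorem quadraticBranchPlusEtaMainConjectureAt_of_hasCM_of_shaAn_unit'
    (hmod : hasEntireLFunction_rat) (hGZK : rank_eq_analyticRank_of_analyticRank_le_one)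
    (hS28 : bsdTriple_of_hasCM_of_L_one_ne_zero)
    (V : WeierstrassCurve ℚ) [V.IsElliptic] [V.IsGloballyMinimal] (C : VariableChange ℚ)
    (hp5 : 5 ≤ p) (hCV : C • W.quadraticTwist ((-1) ^ (p / 2) * p) = V)
    (hgood : V.HasGoodReductionAtPrime p) (hap : V.frobeniusTrace p = 0) (hCM : V.HasCM)
    (hLW : W.entireLFunction 1 ≠ 0) (hsha : ∃ s : ℚ, shaAn W = (s : ℂ) ∧ padicValRat p s ≤ 0) :
    QuadraticBranchPlusEtaMainConjectureAt V p := by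
  have hd : ((-1 : ℚ) ^ (p / 2) * p) ≠ 0 :=
    mul_ne_zero (pow_ne_zero _ (neg_ne_zero.mpr one_ne_zero)) (Nat.cast_ne_zero.mpr hp.out.ne_zero)
  haveI := W.isElliptic_quadraticTwist hd
  have hj : V.j = W.j := by subst hCV; rw [variableChange_j, j_quadraticTwist W hd]
  have hCMW : W.HasCM := (hasCM_iff_of_j_eq hj).mp hCM
  exact quadraticBranchPlusEtaMainConjectureAt_of_hasCM_partner_of_shaAn_unit W p hmod hGZK hS28 V C hp5
    hCV hgood hap hCMW hLW hsha
    (Summit.BirchSwinnertonDyer.Rank1Residual.X12.not_dvd_tamagawaProduct_of_hasCM W hCMW p hp5)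

/-- **(C1⁺_η)(V,p) on a CM rank-`0` pair from the ALGEBRAIC integer `p ∤ #Ш(W)`.** As
`…_of_hasCM_of_shaAn_unit'`, with `v_p(#Ш(W)_an) ≤ 0` supplied by `p ∤ #Ш(W)`: for the CM curve `W`
of analytic rank `0` Burungale–Flach's bsd.S28 gives `BSD(W,p)`, i.e. `v_p(#Ш(W)_an) = ord_p #Ш(W)[p^∞]
= ord_p #Ш(W) = 0`. Named facts: modularity, GZK, bsd.S28. CONDITIONAL; nothing booked.
[cite: BurungaleFlach2024, Thm 1.1 and Cor. 2] [cite: Kobayashi2003, §4 Even main conjecture (p. 8)] -/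
theorem quadraticBranchPlusEtaMainConjectureAt_of_hasCM_of_not_dvd_card_sha
    (hmod : hasEntireLFunction_rat) (hGZK : rank_eq_analyticRank_of_analyticRank_le_one)
    (hS28 : bsdTriple_of_hasCM_of_L_one_ne_zero)
    (V : WeierstrassCurve ℚ) [V.IsElliptic] [V.IsGloballyMinimal] (C : VariableChange ℚ)
    (hp5 : 5 ≤ p) (hCV : C • W.quadraticTwist ((-1) ^ (p / 2) * p) = V)
    (hgood : V.HasGoodReductionAtPrime p) (hap : V.frobeniusTrace p = 0) (hCM : V.HasCM)
    (hLW : W.entireLFunction 1 ≠ 0) (hsha : ¬ p ∣ Nat.card W.sha) :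
    QuadraticBranchPlusEtaMainConjectureAt V p := by
  have hd : ((-1 : ℚ) ^ (p / 2) * p) ≠ 0 :=
    mul_ne_zero (pow_ne_zero _ (neg_ne_zero.mpr one_ne_zero)) (Nat.cast_ne_zero.mpr hp.out.ne_zero)
  haveI := W.isElliptic_quadraticTwist hd
  have hj : V.j = W.j := by subst hCV; rw [variableChange_j, j_quadraticTwist W hd]
  have hCMW : W.HasCM := (hasCM_iff_of_j_eq hj).mp hCM
  -- bsd.S28: `BSD(W,p)`, `Ш(W)` finite; `v_p(#Ш_an) = ord_p #Ш[p^∞] = ord_p #Ш = 0`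
  have hT : W.BSDTriple := hS28 W hCMW hLW
  haveI : Finite W.sha := hT.2.1
  obtain ⟨-, -, q, hq, hvq⟩ := forall_bsdp_of_bsdTriple' W hT p hp.out
  refine quadraticBranchPlusEtaMainConjectureAt_of_hasCM_of_shaAn_unit' W p hmod hGZK hS28 V C hp5 hCV hgood
    hap hCM hLW ⟨q, hq, ?_⟩
  rw [hvq, padicValNat_card_addPrimaryComponent (A := W.sha) p, padicValNat.eq_zero_of_not_dvd hsha]
  simp

end CM

/-- **19606's CM rank-`0` rows are settled modulo print OFF the locus `p ∣ #Ш(W)`.** On the binders of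
`stub_etaMC_cm` (`p ≥ 5`, `V` good with `a_p = 0`, tower NOT onto — displayed, idle — `V` CM) with the
additive partner `W` (`C • W^{(p*)} = V`, globally minimal), `L(W,1) ≠ 0` and `p ∤ #Ш(W)`: the crux's
conclusion `QuadraticBranchPlusEtaMainConjectureAt V p`, granted modularity, GZK and Burungale–Flach's
bsd.S28 (named facts). No Iwasawa-theoretic input, no Tamagawa binder (CM: all bad primes additive).
CONDITIONAL; `stub_etaMC_cm` itself (rank-`1` rows; rows with `p ∣ #Ш(W)`) stays OPEN; nothing booked.
[cite: BurungaleFlach2024, Thm 1.1 and Cor. 2] [cite: Kobayashi2003, §4 Even main conjecture (p. 8)]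
[cite: PollackRubin2004, Theorem and remark p. 448] -/
theorem etaMC_cm_rankZeroRows_of_not_dvd_sha (hmod : hasEntireLFunction_rat)
    (hGZK : rank_eq_analyticRank_of_analyticRank_le_one) (hS28 : bsdTriple_of_hasCM_of_L_one_ne_zero) :
    ∀ (V : WeierstrassCurve ℚ) [V.IsElliptic] [V.IsGloballyMinimal] (p : ℕ) [Fact p.Prime],
      5 ≤ p → V.HasGoodReductionAtPrime p → V.frobeniusTrace p = 0 →
      ¬ (∀ m : ℕ, V.HasSurjectiveModNGaloisRep (p ^ m : ℕ)) → V.HasCM →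
      ∀ (W : WeierstrassCurve ℚ) [W.IsElliptic] [W.IsGloballyMinimal] (C : VariableChange ℚ),
        C • W.quadraticTwist ((-1) ^ (p / 2) * p) = V → W.entireLFunction 1 ≠ 0 →
        ¬ p ∣ Nat.card W.sha → QuadraticBranchPlusEtaMainConjectureAt V p := by
  intro V _ _ p _ hp5 hgood hap _ hCM W _ _ C hCV hLW hsha
  exact quadraticBranchPlusEtaMainConjectureAt_of_hasCM_of_not_dvd_card_sha W p hmod hGZK hS28 V C hp5 hCV
    hgood hap hCM hLW hsha

end EtaUnitRows

end Summit.BirchSwinnertonDyer.BirchSwinnertonDyer.Theorems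

end
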